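import Mathlib
import Summits.KontsevichZagierPeriods.KontsevichZagierPeriods.Theorems.InverseLandauTateLiftingPullback
import Summits.KontsevichZagierPeriods.KontsevichZagierPeriods.Theorems.SymplecticScissorsPlanarSAZylevStubTeCalc

/-!
# `TateLifting` (stmt-KontsevichZagierPeriods-9129), line `Sketch` — stub 50 `AffineChart`:
# the affine engine of the polytope sector

Hilbert's third problem has no obstruction in the Kontsevich–Zagier calculus: an open simplex with
real-algebraic vertices is the image of the open ordered simplex under an affine map `x ↦ Ax + b`
with real-algebraic entries and `det A ≠ 0`, and ONE change of variables (rule (2),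
`KZ.changeOfVariablesRel`) along it relates any representation `[σ, f]` to the honest pull-back
`[{x | Ax + b ∈ σ}, |det A|·f(Ax + b)]`. This file proves the three facts the composition
`simplexGens_toCube_of` of the line consumes:

* (i) `det A` is algebraic over `ℚ` when all entries of `A` are (`det` is an integer polynomial in
  the entries, `IsIntegral.det`);
* (ii) the honest pulled-back representation exists and differs from `[σ, f]` by an element of
  `KZ.relations` — the seven side inputs of `tateLifting_pullback`: the preimage
  `{x | Ax + b ∈ σ}` is `ℚ`-semialgebraic (Tarski–Seidenberg preimage lemma
  `teCalc_isSemialgebraic_preimage`), the affine map is `ℚ`-semialgebraic (coordinates are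
  real-affine with real-algebraic coefficients), has the constant derivative `toLin' A` of
  determinant `det A`, is injective and maps the preimage ONTO `σ` (invertibility), and the
  constant Jacobian `|det A|` is a `ℚ`-semialgebraic function;
* (iii) polynomial bookkeeping over `K = ℚ̄ ∩ ℝ = algebraicClosure ℚ ℝ`: for `c` algebraic and `P`
  a `K`-polynomial, `c · P(Ax + b)` is again (the evaluation of) a `K`-polynomial, namely
  `C c * bind₁ (fun i => ∑ j, C (A i j) * X j + C (b i)) P`.

References: M. Kontsevich, D. Zagier, *Periods* (2001), §1.2 rule (2); J. Bochnak, M. Coste,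
M.-F. Roy, *Real Algebraic Geometry* (1998), §2.2 (Prop. 2.2.6, 2.2.7).
-/

noncomputable section

open MeasureTheory Set
open Literature.NumberTheory.Transcendental
open Literature.ModelTheory.ExponentialFields (IsSemialgebraic)

namespace Summit.KontsevichZagierPeriods.InverseLandau

namespace AffineEngine

variable {n : ℕ}

/-- The affine map `x ↦ A x + b` with real-algebraic `A`, `b` is a `ℚ`-semialgebraic map on every
`ℚ`-semialgebraic set: its coordinates `x ↦ Σₗ A j l · x l + b j` are real-affine with
real-algebraic (hence `ℚ`-definable) coefficients. [cite: BochnakCosteRoy1998, Prop. 2.2.6] -/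
theorem isSemialgebraicMapOn_affine {A : Matrix (Fin n) (Fin n) ℝ} {b : Fin n → ℝ}
    (hA : ∀ i j, IsAlgebraic ℚ (A i j)) (hb : ∀ i, IsAlgebraic ℚ (b i)) {σ : Set (Fin n → ℝ)}
    (hσ : IsSemialgebraic ℚ σ) : IsSemialgebraicMapOn ℚ σ (fun x => A.mulVec x + b) := by
  -- adapted from `HyperbolicBloch.OffTetraSectorKernel.aff_orbit_isSemialgebraicMapOn`
  refine IsSemialgebraicMapOn.of_forall hσ fun j => ?_
  have hsum : IsSemialgebraicFunOn ℚ σ (fun x => ∑ l, A j l * x l) :=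
    KZ.isSemialgebraicFunOn_finset_sum Finset.univ hσ fun l _ =>
      (IsSemialgebraicFunOn.mul_holds (isSemialgebraicFunOn_const_of_isAlgebraic hσ (hA j l))
        (isSemialgebraicFunOn_apply hσ l)).congr fun x _ => rfl
  exact (IsSemialgebraicFunOn.add_holds hsum
    (isSemialgebraicFunOn_const_of_isAlgebraic hσ (hb j))).congr fun x _ => by
      simp [Matrix.mulVec, dotProduct]

/-- The affine map `x ↦ A x + b` with `det A ≠ 0` is injective. [folklore] -/
theorem affine_injective {A : Matrix (Fin n) (Fin n) ℝ} (b : Fin n → ℝ) (hdet : A.det ≠ 0) :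
    Function.Injective (fun x => A.mulVec x + b) := by
  have hU : IsUnit A := (Matrix.isUnit_iff_isUnit_det A).mpr (isUnit_iff_ne_zero.mpr hdet)
  intro x y hxy
  exact Matrix.mulVec_injective_iff_isUnit.mpr hU (add_right_cancel hxy)

/-- The affine map `x ↦ A x + b` with `det A ≠ 0` is surjective: `y = A (A⁻¹ (y - b)) + b`.
[folklore] -/
theorem affine_surjective {A : Matrix (Fin n) (Fin n) ℝ} (b : Fin n → ℝ) (hdet : A.det ≠ 0) :
    Function.Surjective (fun x => A.mulVec x + b) := by
  have hU : IsUnit A.det := isUnit_iff_ne_zero.mpr hdet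
  intro y
  refine ⟨A⁻¹.mulVec (y - b), ?_⟩
  show A.mulVec (A⁻¹.mulVec (y - b)) + b = y
  rw [Matrix.mulVec_mulVec, Matrix.mul_nonsing_inv A hU, Matrix.one_mulVec, sub_add_cancel]

/-- The preimage `{x | A x + b ∈ σ}` of a `ℚ`-semialgebraic set under a real-algebraic affine map is
`ℚ`-semialgebraic (Tarski–Seidenberg). [cite: BochnakCosteRoy1998, Prop. 2.2.7] -/
theorem isSemialgebraic_preimage_affine {A : Matrix (Fin n) (Fin n) ℝ} {b : Fin n → ℝ}
    (hA : ∀ i j, IsAlgebraic ℚ (A i j)) (hb : ∀ i, IsAlgebraic ℚ (b i)) {σ : Set (Fin n → ℝ)}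
    (hσ : IsSemialgebraic ℚ σ) : IsSemialgebraic ℚ {x | A.mulVec x + b ∈ σ} := by
  have h :=
    Summit.KontsevichZagierPeriods.SymplecticScissors.PlanarSAZylev.teCalc_isSemialgebraic_preimage
      (isSemialgebraicMapOn_affine hA hb
        (Literature.ModelTheory.ExponentialFields.isSemialgebraic_univ (k := ℚ) (ι := Fin n)
          (R := ℝ)))
      hσ
  convert h using 1
  ext x
  simp

/-- The determinant of a matrix with real-algebraic entries is real-algebraic (`det` is an integer
polynomial in the entries). [folklore] -/
theorem isAlgebraic_det {A : Matrix (Fin n) (Fin n) ℝ} (hA : ∀ i j, IsAlgebraic ℚ (A i j)) :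
    IsAlgebraic ℚ A.det :=
  isAlgebraic_iff_isIntegral.mpr (IsIntegral.det fun i j => isAlgebraic_iff_isIntegral.mp (hA i j))

/-- **The honest affine pull-back** (rule (2) along `Φ x = A x + b`): for real-algebraic `A`, `b`
with `det A ≠ 0` and any representation `r = [σ, f]`, the representation
`[{x | A x + b ∈ σ}, |det A| · f (A x + b)]` exists and `[σ, f]` minus it lies in `KZ.relations`.
[cite: KontsevichZagier2001, §1.2 rule (2)] -/
theorem exists_pullback (A : Matrix (Fin n) (Fin n) ℝ) (b : Fin n → ℝ)
    (hA : ∀ i j, IsAlgebraic ℚ (A i j)) (hb : ∀ i, IsAlgebraic ℚ (b i)) (hdet : A.det ≠ 0)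
    (r : KZ.IntegralRep n) :
    ∃ r' : KZ.IntegralRep n, r'.domain = {x | A.mulVec x + b ∈ r.domain} ∧
      (r'.integrand = fun x => |A.det| * r.integrand (A.mulVec x + b)) ∧
      KZ.of r - KZ.of r' ∈ KZ.relations := by
  set L : (Fin n → ℝ) →L[ℝ] (Fin n → ℝ) := LinearMap.toContinuousLinearMap (Matrix.toLin' A)
    with hL
  have hLapply : ∀ x, L x = A.mulVec x := fun x => by
    rw [hL, LinearMap.coe_toContinuousLinearMap', Matrix.toLin'_apply]
  have hLdet : L.det = A.det := by
    rw [hL, LinearMap.det_toContinuousLinearMap, LinearMap.det_toLin']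
  have hderiv : ∀ x, HasFDerivAt (fun x => A.mulVec x + b) L x := fun x => by
    have heq : (fun x => A.mulVec x + b) = fun x => L x + b := funext fun x => by rw [hLapply]
    rw [heq]
    exact L.hasFDerivAt.add_const b
  have hD : IsSemialgebraic ℚ {x | A.mulVec x + b ∈ r.domain} :=
    isSemialgebraic_preimage_affine hA hb r.isSemialgebraic_domain
  -- the constant Jacobian `|det A|` is real-algebraic
  have habs : IsAlgebraic ℚ |A.det| := by
    rcases abs_choice A.det with h | h <;> rw [h]
    exacts [isAlgebraic_det hA, (isAlgebraic_det hA).neg]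
  have himage : (fun x => A.mulVec x + b) '' {x | A.mulVec x + b ∈ r.domain} = r.domain :=
    Set.image_preimage_eq r.domain (affine_surjective b hdet)
  exact tateLifting_pullback n r {x | A.mulVec x + b ∈ r.domain} (fun x => A.mulVec x + b)
    (fun _ => L) (fun _ => |A.det|) hD (isSemialgebraicMapOn_affine hA hb hD)
    (fun x _ => (hderiv x).hasFDerivWithinAt) (affine_injective b hdet).injOn himage
    (isSemialgebraicFunOn_const_of_isAlgebraic hD habs)
    (fun _ _ => by rw [hLdet])

/-- **Polynomial bookkeeping over `K = algebraicClosure ℚ ℝ`**: for `c` real-algebraic, `A`, `b`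
real-algebraic and `P` a `K`-polynomial, `x ↦ c · P (A x + b)` is the evaluation of the
`K`-polynomial `C c * bind₁ (fun i => ∑ j, C (A i j) * X j + C (b i)) P`. [folklore] -/
theorem exists_poly (A : Matrix (Fin n) (Fin n) ℝ) (b : Fin n → ℝ)
    (hA : ∀ i j, IsAlgebraic ℚ (A i j)) (hb : ∀ i, IsAlgebraic ℚ (b i)) (c : ℝ)
    (P : MvPolynomial (Fin n) (algebraicClosure ℚ ℝ)) (hc : IsAlgebraic ℚ c) :
    ∃ P' : MvPolynomial (Fin n) (algebraicClosure ℚ ℝ),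
      ∀ x : Fin n → ℝ,
        (MvPolynomial.aeval x P' : ℝ) = c * MvPolynomial.aeval (A.mulVec x + b) P := by
  -- `c = ↑c'` for an element `c'` of `K`
  obtain ⟨c', rfl⟩ : ∃ c' : algebraicClosure ℚ ℝ, (c' : ℝ) = c :=
    ⟨⟨c, mem_algebraicClosure_iff.mpr hc⟩, rfl⟩
  let A' : Fin n → Fin n → algebraicClosure ℚ ℝ := fun i j =>
    ⟨A i j, mem_algebraicClosure_iff.mpr (hA i j)⟩
  let b' : Fin n → algebraicClosure ℚ ℝ := fun i => ⟨b i, mem_algebraicClosure_iff.mpr (hb i)⟩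
  let g : Fin n → MvPolynomial (Fin n) (algebraicClosure ℚ ℝ) := fun i =>
    ∑ j, MvPolynomial.C (A' i j) * MvPolynomial.X j + MvPolynomial.C (b' i)
  refine ⟨MvPolynomial.C c' * MvPolynomial.bind₁ g P, fun x => ?_⟩
  have hg : (fun i => MvPolynomial.aeval x (g i)) = A.mulVec x + b := funext fun i => by
    simp [g, A', b', Matrix.mulVec, dotProduct, map_sum]
  rw [map_mul, MvPolynomial.aeval_C, MvPolynomial.aeval_bind₁, hg,
    IntermediateField.algebraMap_apply]

end AffineEngine

/-- **AFFINE ENGINE** (stub 50 of line `Sketch`): for `A ∈ GL_n` and `b` with real-algebraic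
entries, (i) `det A` is algebraic; (ii) every representation `[σ, f]` differs by an element of
`KZ.relations` from the honest pull-back `[{x | A x + b ∈ σ}, |det A| · f (A x + b)]` (one change of
variables, rule (2)); (iii) `c · P (A x + b)` is again a polynomial over `K = ℚ̄ ∩ ℝ` for `c`
algebraic. [cite: KontsevichZagier2001, §1.2 rule (2)] -/
theorem tateLifting_affineChart :
    ∀ (n : ℕ) (A : Matrix (Fin n) (Fin n) ℝ) (b : Fin n → ℝ),
      (∀ i j, IsAlgebraic ℚ (A i j)) → (∀ i, IsAlgebraic ℚ (b i)) → A.det ≠ 0 →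
      IsAlgebraic ℚ A.det ∧
      (∀ r : KZ.IntegralRep n, ∃ r' : KZ.IntegralRep n,
        r'.domain = {x | A.mulVec x + b ∈ r.domain} ∧
        (r'.integrand = fun x => |A.det| * r.integrand (A.mulVec x + b)) ∧
        KZ.of r - KZ.of r' ∈ KZ.relations) ∧
      (∀ (c : ℝ) (P : MvPolynomial (Fin n) (algebraicClosure ℚ ℝ)), IsAlgebraic ℚ c →
        ∃ P' : MvPolynomial (Fin n) (algebraicClosure ℚ ℝ),
          ∀ x : Fin n → ℝ, (MvPolynomial.aeval x P' : ℝ) =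
            c * MvPolynomial.aeval (A.mulVec x + b) P) :=
  fun _ A b hA hb hdet =>
    ⟨AffineEngine.isAlgebraic_det hA, fun r => AffineEngine.exists_pullback A b hA hb hdet r,
      fun c P hc => AffineEngine.exists_poly A b hA hb c P hc⟩

end Summit.KontsevichZagierPeriods.InverseLandau

end
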